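import Summits.Ventures.PercRepro.C041TriDomTwoCutSibling
import Summits.Ventures.PercRepro.C041TriDomParallelInduction

/-!
# ROW C-041 — THEOREM (REDUCTION, 2-CUT FORM): THE INDUCTION ON A STOCKED HOST
(p6, gen 46; P6-TWOEXIT-LEAN.md §53 ADDENDUM 18)

THEOREM (2-CUT GLUING) replaces a markless far side by a chord, which the host must carry as an ABSENT edge.  A
status is STOCKED (`Stocked`) if every pair of distinct vertices is joined by at least `npres st` absent edges
(`stock`); a 2-cut reduction consumes one chord of one pair and lowers the number of present edges by at least one
(the far side carries at least two present edges, `HasTwoCut`), the other reductions only make edges absent or a free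
edge double — so the stock is preserved along the whole induction (`stocked_stOutS`, `stocked_stDel`,
`stocked_stCon`, `stocked_stAbs`, `stocked_stOut2S`, `stocked_stChord`, `stocked_stDbl`).  **THEOREM (REDUCTION,
2-CUT FORM)** (`cyc_and_sib_of_stockedCore`): if CONJECTURE (STOCHASTIC DOMINATION) and the sibling hold, for all
marks, on every stocked status without a cut, a two-exit piece, a redundant edge, a parallel pair or a markless
2-cut far side, they hold on every stocked status.  The measure is `muTE` of `C041TriDomTwoExitInduction`
(`muTE_stOut2S_lt`, `muTE_stChord_lt`, `muTE_stDbl_lt`).  READING: on a stocked host the open core of the conjecture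
is «3-connected modulo the marks» — every unmarked vertex has degree `≥ 3` and every pair whose removal disconnects
leaves marks on every side.  A plain host is a stocked status of its host with the stock added (its absent chords are
invisible to the classes): the embedding is the next item.
-/

namespace PercRepro

namespace ZoneZ

namespace MultiExit

open ZoneData Finset Classical

variable {V₁ E₁ U₁ U₂ : Type} (Z₁ : ZoneData V₁ E₁ U₁ U₂) [Fintype E₁] [DecidableEq E₁]

/-! ## The stock -/

/-- The stock of a pair: the absent edges joining `u` and `v`. -/
noncomputable def stock (st : E₁ → EStat) (u v : V₁) : ℕ :=
  (univ.filter fun e => st e = EStat.absent ∧ Z₁.Joins e u v).card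

/-- A status is stocked: every pair of distinct vertices has at least `npres st` absent edges joining it. -/
def Stocked (st : E₁ → EStat) : Prop := ∀ u v : V₁, u ≠ v → npres st ≤ stock Z₁ st u v

omit [DecidableEq E₁] in
/-- The stock grows when edges are made absent and nothing else changes. -/
theorem stock_mono {st st' : E₁ → EStat} (h : ∀ e, st e = EStat.absent → st' e = EStat.absent) (u v : V₁) :
    stock Z₁ st u v ≤ stock Z₁ st' u v := by
  unfold stock
  apply Finset.card_le_card
  intro e he
  rw [Finset.mem_filter] at he ⊢
  exact ⟨he.1, h e he.2.1, he.2.2⟩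

omit [DecidableEq E₁] in
/-- A status with fewer present edges and more absent edges stays stocked. -/
theorem stocked_of_le {st st' : E₁ → EStat} (hs : Stocked Z₁ st) (hn : npres st' ≤ npres st)
    (h : ∀ e, st e = EStat.absent → st' e = EStat.absent) : Stocked Z₁ st' :=
  fun u v huv => hn.trans ((hs u v huv).trans (stock_mono Z₁ h u v))

omit [Fintype E₁] in
/-- Making an edge absent keeps the absent edges. -/
theorem absent_stAbs {st : E₁ → EStat} (f : E₁) : ∀ e, st e = EStat.absent → stAbs st f e = EStat.absent := by
  intro e he
  unfold stAbs
  by_cases h : e = f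
  · rw [if_pos h]
  · rw [if_neg h]
    exact he

omit [Fintype E₁] in
/-- Contracting a free edge keeps the absent edges. -/
theorem absent_stCon {st : E₁ → EStat} {f : E₁} (hf : st f = EStat.free) :
    ∀ e, st e = EStat.absent → stCon st f e = EStat.absent := by
  intro e he
  unfold stCon
  by_cases h : e = f
  · rw [h, hf] at he
    exact absurd he (by decide)
  · rw [if_neg h]
    exact he

omit [Fintype E₁] [DecidableEq E₁] in
/-- Deleting a side keeps the absent edges. -/
theorem absent_stOutS {st : E₁ → EStat} (v w : V₁) :
    ∀ e, st e = EStat.absent → stOutS Z₁ st v w e = EStat.absent := by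
  intro e he
  unfold stOutS
  by_cases h : InCS Z₁ st v w e
  · rw [if_pos h]
  · rw [if_neg h]
    exact he

omit [Fintype E₁] in
/-- Deleting the two exits keeps the absent edges. -/
theorem absent_stDel {st : E₁ → EStat} (f₁ f₂ : E₁) :
    ∀ e, st e = EStat.absent → stDel st f₁ f₂ e = EStat.absent := by
  intro e he
  unfold stDel
  by_cases h : e = f₁ ∨ e = f₂
  · rw [if_pos h]
  · rw [if_neg h]
    exact he

omit [Fintype E₁] [DecidableEq E₁] in
/-- Deleting a far side keeps the absent edges. -/
theorem absent_stOut2S {st : E₁ → EStat} (u v w : V₁) :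
    ∀ e, st e = EStat.absent → stOut2S Z₁ st u v w e = EStat.absent := by
  intro e he
  unfold stOut2S
  by_cases h : InC2S Z₁ st u v w e
  · rw [if_pos h]
  · rw [if_neg h]
    exact he

omit [DecidableEq E₁] in
/-- The number of present edges never grows when edges are made absent. -/
theorem npres_le_of_pres {st st' : E₁ → EStat} (h : ∀ e, presE st' e → presE st e) : npres st' ≤ npres st := by
  unfold npres
  apply Finset.card_le_card
  intro e he
  rw [Finset.mem_filter] at he ⊢
  exact ⟨he.1, h e he.2⟩

omit [DecidableEq E₁] in
/-- `stOutS` keeps a status stocked. -/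
theorem stocked_stOutS {st : E₁ → EStat} (hs : Stocked Z₁ st) (v w : V₁) : Stocked Z₁ (stOutS Z₁ st v w) :=
  stocked_of_le Z₁ hs (npres_le_of_pres fun _ he => (presE_stOutS Z₁ st v w he).1) (absent_stOutS Z₁ v w)

/-- `stDel` keeps a status stocked. -/
theorem stocked_stDel {st : E₁ → EStat} (hs : Stocked Z₁ st) (f₁ f₂ : E₁) : Stocked Z₁ (stDel st f₁ f₂) :=
  stocked_of_le Z₁ hs (npres_le_of_pres fun _ he => (presE_stDel he).1) (absent_stDel f₁ f₂)

/-- `stAbs` keeps a status stocked. -/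
theorem stocked_stAbs {st : E₁ → EStat} (hs : Stocked Z₁ st) (f : E₁) : Stocked Z₁ (stAbs st f) :=
  stocked_of_le Z₁ hs (npres_le_of_pres fun _ he => (presE_stAbs he).1) (absent_stAbs f)

/-- `stCon` keeps a status stocked. -/
theorem stocked_stCon {st : E₁ → EStat} (hs : Stocked Z₁ st) {f : E₁} (hf : st f = EStat.free) :
    Stocked Z₁ (stCon st f) :=
  stocked_of_le Z₁ hs (le_of_eq (npres_stCon_eq hf)) (absent_stCon hf)

omit [DecidableEq E₁] in
/-- `stOut2S` keeps a status stocked. -/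
theorem stocked_stOut2S {st : E₁ → EStat} (hs : Stocked Z₁ st) (u v w : V₁) : Stocked Z₁ (stOut2S Z₁ st u v w) :=
  stocked_of_le Z₁ hs (npres_le_of_pres fun e he => by
    unfold presE stOut2S at he
    by_cases h : InC2S Z₁ st u v w e
    · rw [if_pos h] at he
      exact absurd rfl he
    · rw [if_neg h] at he
      exact he) (absent_stOut2S Z₁ u v w)

/-! ## Two present far edges: the chord statuses have fewer present edges -/

/-- The far side carries two present edges. -/
def TwoFar (st : E₁ → EStat) (u v w : V₁) : Prop :=
  ∃ e₁ e₂ : E₁, e₁ ≠ e₂ ∧ presE st e₁ ∧ presE st e₂ ∧ InC2S Z₁ st u v w e₁ ∧ InC2S Z₁ st u v w e₂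

/-- Deleting a far side with two present edges lowers the number of present edges by two. -/
theorem npres_stOut2S_add_two_le {st : E₁ → EStat} {u v w : V₁} (h : TwoFar Z₁ st u v w) :
    npres (stOut2S Z₁ st u v w) + 2 ≤ npres st := by
  obtain ⟨e₁, e₂, hne, h₁, h₂, hi₁, hi₂⟩ := h
  unfold npres
  have hsub : (univ.filter fun e => presE (stOut2S Z₁ st u v w) e) ⊆
      (univ.filter fun e => presE st e) \ {e₁, e₂} := by
    intro e he
    rw [Finset.mem_filter] at he
    rw [Finset.mem_sdiff, Finset.mem_filter, Finset.mem_insert, Finset.mem_singleton]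
    have hp : presE st e ∧ ¬ InC2S Z₁ st u v w e := by
      unfold presE stOut2S at he
      by_cases hc : InC2S Z₁ st u v w e
      · rw [if_pos hc] at he
        exact absurd rfl he.2
      · rw [if_neg hc] at he
        exact ⟨he.2, hc⟩
    refine ⟨⟨Finset.mem_univ _, hp.1⟩, ?_⟩
    rintro (rfl | rfl)
    · exact hp.2 hi₁
    · exact hp.2 hi₂
  have hsd : ((univ.filter fun e => presE st e) \ {e₁, e₂}).card + 2 = (univ.filter fun e => presE st e).card := by
    rw [Finset.card_sdiff_of_subset, Finset.card_pair hne]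
    · have : 2 ≤ (univ.filter fun e => presE st e).card := by
        rw [← Finset.card_pair hne]
        apply Finset.card_le_card
        intro e he
        rw [Finset.mem_insert, Finset.mem_singleton] at he
        rw [Finset.mem_filter]
        rcases he with rfl | rfl
        · exact ⟨Finset.mem_univ _, h₁⟩
        · exact ⟨Finset.mem_univ _, h₂⟩
      omega
    · intro e he
      rw [Finset.mem_insert, Finset.mem_singleton] at he
      rw [Finset.mem_filter]
      rcases he with rfl | rfl
      · exact ⟨Finset.mem_univ _, h₁⟩
      · exact ⟨Finset.mem_univ _, h₂⟩
  have := Finset.card_le_card hsub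
  omega

/-- Making one absent edge present raises the number of present edges by at most one. -/
theorem npres_update_le {st : E₁ → EStat} (c₀ : E₁) (s : EStat) :
    npres (fun e => if e = c₀ then s else st e) ≤ npres st + 1 := by
  unfold npres
  have hsub : (univ.filter fun e => presE (fun e => if e = c₀ then s else st e) e) ⊆
      insert c₀ (univ.filter fun e => presE st e) := by
    intro e he
    rw [Finset.mem_filter] at he
    rw [Finset.mem_insert, Finset.mem_filter]
    by_cases hec : e = c₀
    · exact Or.inl hec
    · refine Or.inr ⟨Finset.mem_univ _, ?_⟩
      have he2 : (if e = c₀ then s else st e) ≠ EStat.absent := he.2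
      rw [if_neg hec] at he2
      exact he2
  exact (Finset.card_le_card hsub).trans (Finset.card_insert_le _ _)

/-- The chord status has fewer present edges than `st`. -/
theorem npres_stChord_lt {st : E₁ → EStat} {u v w : V₁} (c₀ : E₁) (h : TwoFar Z₁ st u v w) :
    npres (stChord Z₁ st u v w c₀) < npres st := by
  have h1 := npres_stOut2S_add_two_le Z₁ h
  have h2 := npres_update_le (st := stOut2S Z₁ st u v w) c₀ EStat.free
  unfold stChord
  omega

/-- The double-chord status has fewer present edges than `st`. -/
theorem npres_stDbl_lt {st : E₁ → EStat} {u v w : V₁} (c₀ : E₁) (h : TwoFar Z₁ st u v w) :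
    npres (stDbl Z₁ st u v w c₀) < npres st := by
  have h1 := npres_stOut2S_add_two_le Z₁ h
  have h2 := npres_update_le (st := stOut2S Z₁ st u v w) c₀ EStat.double
  unfold stDbl
  omega

/-- The stock of a pair drops by at most one when one edge changes status. -/
theorem stock_update_ge {st : E₁ → EStat} (c₀ : E₁) (s : EStat) (u v : V₁) :
    stock Z₁ st u v ≤ stock Z₁ (fun e => if e = c₀ then s else st e) u v + 1 := by
  unfold stock
  have hsub : (univ.filter fun e => st e = EStat.absent ∧ Z₁.Joins e u v) ⊆
      insert c₀ (univ.filter fun e => (fun e => if e = c₀ then s else st e) e = EStat.absent ∧ Z₁.Joins e u v) := by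
    intro e he
    rw [Finset.mem_filter] at he
    rw [Finset.mem_insert, Finset.mem_filter]
    by_cases hec : e = c₀
    · exact Or.inl hec
    · refine Or.inr ⟨Finset.mem_univ _, ?_, he.2.2⟩
      simp only [if_neg hec]
      exact he.2.1
  exact (Finset.card_le_card hsub).trans (Finset.card_insert_le _ _)

/-- The chord status of a stocked status with two present far edges is stocked. -/
theorem stocked_stChord {st : E₁ → EStat} (hs : Stocked Z₁ st) {u v w : V₁} (c₀ : E₁) (h : TwoFar Z₁ st u v w) :
    Stocked Z₁ (stChord Z₁ st u v w c₀) := by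
  intro a b hab
  have h1 := npres_stChord_lt Z₁ c₀ h
  have h2 := hs a b hab
  have h3 := stock_mono Z₁ (absent_stOut2S Z₁ (st := st) u v w) a b
  have h4 := stock_update_ge Z₁ (st := stOut2S Z₁ st u v w) c₀ EStat.free a b
  unfold stChord
  unfold stChord at h1
  omega

/-- The double-chord status of a stocked status with two present far edges is stocked. -/
theorem stocked_stDbl {st : E₁ → EStat} (hs : Stocked Z₁ st) {u v w : V₁} (c₀ : E₁) (h : TwoFar Z₁ st u v w) :
    Stocked Z₁ (stDbl Z₁ st u v w c₀) := by
  intro a b hab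
  have h1 := npres_stDbl_lt Z₁ c₀ h
  have h2 := hs a b hab
  have h3 := stock_mono Z₁ (absent_stOut2S Z₁ (st := st) u v w) a b
  have h4 := stock_update_ge Z₁ (st := stOut2S Z₁ st u v w) c₀ EStat.double a b
  unfold stDbl
  unfold stDbl at h1
  omega

/-! ## The measure drops -/

/-- The measure drops under the deletion of a far side with two present edges. -/
theorem muTE_stOut2S_lt {st : E₁ → EStat} {u v w : V₁} (h : TwoFar Z₁ st u v w) :
    muTE (stOut2S Z₁ st u v w) < muTE st :=
  μ_lt_of_npres_lt st (by have := npres_stOut2S_add_two_le Z₁ h; omega)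

/-- The measure drops under the chord reduction. -/
theorem muTE_stChord_lt {st : E₁ → EStat} {u v w : V₁} (c₀ : E₁) (h : TwoFar Z₁ st u v w) :
    muTE (stChord Z₁ st u v w c₀) < muTE st :=
  μ_lt_of_npres_lt st (npres_stChord_lt Z₁ c₀ h)

/-- The measure drops under the double-chord reduction. -/
theorem muTE_stDbl_lt {st : E₁ → EStat} {u v w : V₁} (c₀ : E₁) (h : TwoFar Z₁ st u v w) :
    muTE (stDbl Z₁ st u v w c₀) < muTE st :=
  μ_lt_of_npres_lt st (npres_stDbl_lt Z₁ c₀ h)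

/-! ## The reduction on a stocked host -/

/-- The status has a markless 2-cut far side with two present edges and a chord in stock. -/
def HasTwoCut (st : E₁ → EStat) (a b c : V₁) : Prop :=
  ∃ (u v w : V₁) (c₀ : E₁), w ≠ u ∧ w ≠ v ∧ st c₀ = EStat.absent ∧ Z₁.Joins c₀ u v ∧
    a ∉ side2 Z₁ st u v w ∧ b ∉ side2 Z₁ st u v w ∧ c ∉ side2 Z₁ st u v w ∧ TwoFar Z₁ st u v w

/-- The induction step at a status with a markless 2-cut far side. -/
theorem step_of_hasTwoCut (st : E₁ → EStat) (hs : Stocked Z₁ st) (a b c : V₁) (h2 : HasTwoCut Z₁ st a b c)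
    (ih : ∀ st' : E₁ → EStat, Stocked Z₁ st' → muTE st' < muTE st → ∀ a' b' c' : V₁,
      CycDominationS Z₁ a' b' c' st' ∧ SibDominationS Z₁ a' b' c' st') :
    CycDominationS Z₁ a b c st ∧ SibDominationS Z₁ a b c st := by
  obtain ⟨u, v, w, c₀, hwu, hwv, hc₀, hc, ha, hb, hcm, hfar⟩ := h2
  have IHN := ih (stOut2S Z₁ st u v w) (stocked_stOut2S Z₁ hs u v w) (muTE_stOut2S_lt Z₁ hfar) a b c
  have IHD := ih (stDbl Z₁ st u v w c₀) (stocked_stDbl Z₁ hs c₀ hfar) (muTE_stDbl_lt Z₁ c₀ hfar) a b c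
  have IHC := ih (stChord Z₁ st u v w c₀) (stocked_stChord Z₁ hs c₀ hfar) (muTE_stChord_lt Z₁ c₀ hfar) a b c
  exact ⟨cycDominationS_of_twoCut Z₁ hwu hwv hc₀ hc a b c ha hb hcm IHN.1 IHD.1 IHC.1,
    sibDominationS_of_twoCut Z₁ hwu hwv hc₀ hc a b c ha hb hcm IHN.2 IHD.2 IHC.2⟩

/-- **THEOREM (REDUCTION, 2-CUT FORM)**: on a stocked host, if the conjecture and the sibling domination hold, for all
marks, on every stocked status without a cut, a two-exit piece, a redundant edge, a parallel pair or a markless 2-cut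
far side, they hold on every stocked status. -/
theorem cyc_and_sib_of_stockedCore
    (hbase : ∀ st : E₁ → EStat, Stocked Z₁ st → ∀ a b c : V₁, ¬ HasCut Z₁ st a b c → ¬ HasTwoExit Z₁ st a b c →
      ¬ HasRedundant Z₁ st → ¬ HasParallel Z₁ st → ¬ HasTwoCut Z₁ st a b c →
      CycDominationS Z₁ a b c st ∧ SibDominationS Z₁ a b c st) :
    ∀ st : E₁ → EStat, Stocked Z₁ st → ∀ a b c : V₁, CycDominationS Z₁ a b c st ∧ SibDominationS Z₁ a b c st := by
  intro st
  suffices h : ∀ n : ℕ, ∀ st : E₁ → EStat, muTE st = n → Stocked Z₁ st → ∀ a b c : V₁,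
      CycDominationS Z₁ a b c st ∧ SibDominationS Z₁ a b c st from h _ st rfl
  intro n
  induction n using Nat.strong_induction_on with
  | _ n ih =>
    intro st hst hs a b c
    have ih' : ∀ st' : E₁ → EStat, Stocked Z₁ st' → muTE st' < muTE st → ∀ a' b' c' : V₁,
        CycDominationS Z₁ a' b' c' st' ∧ SibDominationS Z₁ a' b' c' st' :=
      fun st' hs' hlt => ih (muTE st') (hst ▸ hlt) st' rfl hs'
    by_cases hcut : HasCut Z₁ st a b c
    · -- the side deletion of `step_of_hasCut` keeps the status stocked
      obtain ⟨v, w, hw, ⟨e₀, he₀, hp₀⟩, hcase⟩ := hcut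
      have hlt := npres_stOutS_lt Z₁ st v w he₀ hp₀
      have IH := ih' (stOutS Z₁ st v w) (stocked_stOutS Z₁ hs v w) (μ_lt_of_npres_lt st hlt)
      rcases hcase with ⟨rfl, ha, hb⟩ | ⟨rfl, hb, hc⟩ | ⟨rfl, ha, hc⟩ | ⟨ha, hb, hc⟩
      · exact ⟨cycDominationS_of_cutVertex Z₁ st a b w v hw ha hb (IH a b v).1 (IH a b v).2,
          sibDominationS_of_cutVertex_terminal Z₁ st a b w v hw ha hb (IH a b v).2⟩
      · exact ⟨(cycDominationS_rot Z₁ st w b c).mpr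
            (cycDominationS_of_cutVertex Z₁ st b c w v hw hb hc (IH b c v).1 (IH b c v).2),
          sibDominationS_of_cutVertex_markx Z₁ st w b c v hw hb hc (IH v b c).2⟩
      · exact ⟨(cycDominationS_rot Z₁ st a w c).mpr ((cycDominationS_rot Z₁ st w c a).mpr
            (cycDominationS_of_cutVertex Z₁ st c a w v hw hc ha (IH c a v).1 (IH c a v).2)),
          sibDominationS_of_cutVertex_marky Z₁ st a w c v hw ha hc (IH a v c).2⟩
      · exact ⟨cycDominationS_of_marklessSide Z₁ st v w hw a b c ha hb hc (IH a b c).1,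
          sibDominationS_of_marklessSide Z₁ st v w hw a b c ha hb hc (IH a b c).2⟩
    · by_cases h2 : HasTwoExit Z₁ st a b c
      · obtain ⟨K, u, v, f₁, f₂, hT, ha, hb, hc⟩ := h2
        have IH₀ := ih' (stDel st f₁ f₂) (stocked_stDel Z₁ hs f₁ f₂) (μ_stDel_lt Z₁ hT) a b c
        have IH₁ := ih' (stCon st f₁) (stocked_stCon Z₁ hs hT.hs₁) (μ_stCon_lt hT.hs₁) a b c
        exact ⟨cycDominationS_of_twoExit Z₁ hT a b c ha hb hc IH₀.1 IH₁.1,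
          sibDominationS_of_twoExit Z₁ hT a b c ha hb hc IH₀.2 IH₁.2⟩
      · by_cases h3 : HasRedundant Z₁ st
        · obtain ⟨f, p, q, hf, hj, hpq⟩ := h3
          have IH := ih' (stAbs st f) (stocked_stAbs Z₁ hs f) (μ_stAbs_lt hf) a b c
          exact ⟨cycDominationS_of_redundant Z₁ hf hj hpq a b c IH.1,
            sibDominationS_of_redundant Z₁ hf hj hpq a b c IH.2⟩
        · by_cases h4 : HasParallel Z₁ st
          · obtain ⟨f₁, f₁', p, q, p', q', hP⟩ := h4
            have IH₀ := ih' (stAbs (stCon st f₁) f₁') (stocked_stAbs Z₁ (stocked_stCon Z₁ hs hP.hs₁) f₁')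
              (μ_stAbsCon_lt hP.hne hP.hs₁ hP.hs₁') a b c
            have IH₁ := ih' (stAbs st f₁) (stocked_stAbs Z₁ hs f₁) (μ_stAbs_lt hP.hs₁) a b c
            exact ⟨cycDominationS_of_parallel Z₁ hP a b c IH₀.1 IH₁.1,
              sibDominationS_of_parallel Z₁ hP a b c IH₀.2 IH₁.2⟩
          · by_cases h5 : HasTwoCut Z₁ st a b c
            · exact step_of_hasTwoCut Z₁ st hs a b c h5 ih'
            · exact hbase st hs a b c hcut h2 h3 h4 h5

/-- CONJECTURE (STOCHASTIC DOMINATION) on a stocked status, from the stocked cores. -/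
theorem cycDominationS_of_stockedCore
    (hbase : ∀ st : E₁ → EStat, Stocked Z₁ st → ∀ a b c : V₁, ¬ HasCut Z₁ st a b c → ¬ HasTwoExit Z₁ st a b c →
      ¬ HasRedundant Z₁ st → ¬ HasParallel Z₁ st → ¬ HasTwoCut Z₁ st a b c →
      CycDominationS Z₁ a b c st ∧ SibDominationS Z₁ a b c st)
    {st : E₁ → EStat} (hs : Stocked Z₁ st) (x y z : V₁) : CycDominationS Z₁ x y z st :=
  (cyc_and_sib_of_stockedCore Z₁ hbase st hs x y z).1

end MultiExit

end ZoneZ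

end PercRepro
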